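import Summits.ResolutionOfSingularities.ResolutionOfSingularities.Theorems.DeltaCutStellarJetRing
import Summits.ResolutionOfSingularities.ResolutionOfSingularities.Theorems.DeltaCutStellarWild
import Summits.ResolutionOfSingularities.ResolutionOfSingularities.Theorems.FrobeniusClosingPatchingRelPerfectMonomialFormat
import Literature.AlgebraicGeometry.Resolution.OriginLocalRing
import Literature.AlgebraicGeometry.Resolution.RegularSystemOfParameters
import Mathlib.Algebra.MvPolynomial.PDeriv
import HarnessLib

/-!
# DeltaCut classes, slice T19d-i — THE COORDINATE MODEL `Spec 𝔽₂[x₀,x₁,x₂]_{(x)}` for the jet-cut test data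

Route `MaxContactCut`, column `E1TopNoAbs`; decomposition lineage `decomp-res-lens-6` (g35, window (a) kernel inhabitants).

The KERNEL OBJECTS on which the g35 inhabitant / non-inhabitant theorems (`DeltaCutStellarJetInhabitant`) are stated:

* `S = 𝔽₂[X₀,X₁,X₂]_{(X₀,X₁,X₂)}` (`OriginLocalization (ZMod 2) 3`, a regular local ring of dimension `3` with `2 = 0`), its
  regular system of parameters `x j` (`span_range_x`, `isRsopPart_x`), `Xs = Spec S`;
* the COORDINATE HYPERPLANES `D j = (x j)~` (distinct: `D_injective`; s.n.c.: `hasSNC_frame`), the labelled frames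
  `frame a = [(D 0, a 0), (D 1, a 1), (D 2, a 2)]` with `H = D 0` (`expOf_frame`, `monomialIdeal_frame`);
* stalk bookkeeping through the structure maps `φ p : S → 𝒪_p` (`stalkIdeal_span`, `mem_maximalIdeal_iff`, `maximalIdeal_stalk_eq`);
* the derivation `∂/∂x₁` on `S` and on every stalk (`exists_isDeriv_S`, `exists_isDeriv_stalk`; bare-function derivations `IsDeriv`, T19a);
* the RESIDUE DICHOTOMY over `𝔽₂`: every germ at the closed point is `≡ 0` or `≡ 1 (mod 𝔪)` (`mem_or_sub_one_mem`, `stalk_mem_or_sub_one_mem`).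
-/

open CategoryTheory AlgebraicGeometry Literature.AlgebraicGeometry.Resolution IsLocalRing

namespace Summit.ResolutionOfSingularities.ResolutionOfSingularities.Theorems.DeltaCutClasses

namespace JetModel

/-! ## The base ring -/

/-- `P = 𝔽₂[X₀, X₁, X₂]`. -/
abbrev P : Type := MvPolynomial (Fin 3) (ZMod 2)

/-- `S = 𝔽₂[X₀, X₁, X₂]_{(X)}`, the local ring of `𝔸³_{𝔽₂}` at the origin. -/
abbrev S : Type := OriginLocalization (ZMod 2) 3

/-- the coordinates `x j ∈ S`. -/
noncomputable abbrev x (j : Fin 3) : S := algebraMap P S (MvPolynomial.X j)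

/-- `(x₀, x₁, x₂) = 𝔪_S`. [folklore] -/
theorem span_range_x : Ideal.span (Set.range x) = maximalIdeal S := by
  rw [← IsLocalization.AtPrime.map_eq_maximalIdeal (originIdeal (ZMod 2) 3) S,
    congrArg (Ideal.map (algebraMap P S)) (originIdeal_eq_span (F := ZMod 2) (n := 3)), Ideal.map_span,
    ← Set.range_comp]
  rfl

/-- `𝔪_S` needs exactly `3` generators. [folklore] -/
theorem spanFinrank_S : (maximalIdeal S).spanFinrank = 3 := by
  have h := IsRegularLocalRing.spanFinrank_maximalIdeal (R := S)
  rw [ringKrullDim_originLocalization] at h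
  exact_mod_cast h

/-- `x` is a regular system of parameters of `S`. [folklore] -/
theorem isRsopPart_x : IsRsopPart x := by
  simpa using isRsopPart_comp_of_rsop spanFinrank_S x span_range_x id Function.injective_id

/-- The coordinates lie in the maximal ideal of `S`. [folklore] -/
theorem x_mem (j : Fin 3) : x j ∈ maximalIdeal S :=
  span_range_x ▸ Ideal.subset_span ⟨j, rfl⟩

/-- minimality of the r.s.o.p.: `x j ∉ (x i)` for `i ≠ j`. [folklore] -/
theorem x_notMem_span {i j : Fin 3} (h : i ≠ j) : x j ∉ Ideal.span {x i} := by
  have := not_mem_span_image_of_not_mem spanFinrank_S x span_range_x (S := ({i} : Set (Fin 3))) (i := j)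
    (by simpa using h.symm)
  simpa [Set.image_singleton] using this

/-- `x₁ ∉ (x₀, x₂)`. [folklore] -/
theorem x_one_notMem_span : x 1 ∉ Ideal.span (x '' (({0, 2} : Finset (Fin 3)) : Set (Fin 3))) :=
  not_mem_span_image_of_not_mem spanFinrank_S x span_range_x (by decide)

/-- `2 = 0` in `S`. -/
theorem two_eq_zero : (2 : S) = 0 := by
  have h : ((2 : ℕ) : S) = 0 := by
    rw [← map_natCast (algebraMap P S) 2, CharP.cast_eq_zero, map_zero]
  simpa using h

/-- `3 = 1` in `S` (characteristic `2`). [folklore] -/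
theorem three_eq_one : (3 : S) = 1 := by
  rw [show (3 : S) = 2 + 1 by norm_num, two_eq_zero, zero_add]

/-! ## The scheme, the coordinate hyperplanes, the frames -/

/-- `Xs = Spec S`. -/
noncomputable abbrev Xs : Scheme.{0} := Spec (.of S)

/-- the coordinate hyperplane `D j = (x j)~`. -/
noncomputable abbrev D (j : Fin 3) : Xs.IdealSheafData := affineBlowup.idealSheaf (Ideal.span {x j})

/-- the hypersurface of maximal contact `H = V(x₀)`. -/
noncomputable abbrev H : Xs.IdealSheafData := D 0

/-- the labelled frame `[(D 0, a 0), (D 1, a 1), (D 2, a 2)]`. -/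
noncomputable abbrev frame (a : Fin 3 → ℕ) : List (Xs.IdealSheafData × ℕ) :=
  List.ofFn fun j => (affineBlowup.idealSheaf (Ideal.span {x j}), a j)

/-- A point lies on the coordinate hyperplane `D j` iff `x j` lies in its prime. [folklore] -/
theorem mem_support_D (j : Fin 3) (p : Xs) : p ∈ (D j).support ↔ x j ∈ p.asIdeal :=
  DepthTargets.mem_support_idealSheaf_span_singleton_iff (x j) p

/-- the generic point of `V(x i)`. -/
noncomputable def gen (i : Fin 3) : Xs :=
  (⟨Ideal.span {x i}, (Ideal.span_singleton_prime (isRsopPart_x.prime i).ne_zero).mpr (isRsopPart_x.prime i)⟩ :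
    PrimeSpectrum S)

/-- The prime of the generic point of `D i` is `(x i)`. [folklore] -/
theorem gen_asIdeal (i : Fin 3) : (gen i).asIdeal = Ideal.span {x i} := rfl

/-- The coordinate hyperplanes are pairwise distinct ideal sheaves. [folklore] -/
theorem D_injective : Function.Injective D := by
  intro i j hij
  by_contra hne
  have hi : gen i ∈ (D i).support := (mem_support_D i _).mpr (Ideal.mem_span_singleton_self _)
  rw [hij] at hi
  exact x_notMem_span hne ((mem_support_D j _).mp hi)

/-- The boundary of the coordinate frame is the list of coordinate hyperplanes. [folklore] -/
theorem boundaryOf_frame (a : Fin 3 → ℕ) : boundaryOf (frame a) = List.ofFn D := by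
  rw [boundaryOf, List.map_ofFn]; rfl

/-- Membership in `H :: boundaryOf (frame a)` = being a coordinate hyperplane. [folklore] -/
theorem mem_cons_boundaryOf_frame_iff (a : Fin 3 → ℕ) {K : Xs.IdealSheafData} :
    K ∈ H :: boundaryOf (frame a) ↔ ∃ j, D j = K := by
  rw [boundaryOf_frame, List.mem_cons, List.mem_ofFn']
  constructor
  · rintro (rfl | ⟨j, hj⟩)
    exacts [⟨0, rfl⟩, ⟨j, hj⟩]
  · rintro ⟨j, rfl⟩
    exact Or.inr ⟨j, rfl⟩

/-- `H = D 0` is a member of the frame. [folklore] -/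
theorem H_mem_boundaryOf_frame (a : Fin 3 → ℕ) : H ∈ boundaryOf (frame a) := by
  rw [boundaryOf_frame, List.mem_ofFn']
  exact ⟨0, rfl⟩

/-- **The frame `H :: [D 0, D 1, D 2]` is s.n.c.** (coordinate hyperplanes of a regular local ring; T-DepthTargets). [folklore] -/
theorem hasSNC_frame (a : Fin 3 → ℕ) : HasSNC (H :: boundaryOf (frame a)) := by
  refine HasSNC.of_subset (E := List.ofFn D) (fun K hK => ?_)
    (DepthTargets.hasSNC_coordinateHyperplanes x span_range_x spanFinrank_S)
  obtain ⟨j, rfl⟩ := (mem_cons_boundaryOf_frame_iff a).mp hK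
  exact (List.mem_ofFn' _ _).mpr ⟨j, rfl⟩

/-- exponents on the frame: `expOf (frame a) (D j) = a j`. [folklore] -/
theorem expOf_frame (a : Fin 3 → ℕ) (j : Fin 3) : expOf (frame a) (D j) = a j := by
  classical
  unfold expOf
  rw [weightOf_ofFn, Finset.sum_eq_single j]
  · simp
  · intro i _ hij
    have : ¬ (affineBlowup.idealSheaf (Ideal.span {x i}) : Xs.IdealSheafData) = affineBlowup.idealSheaf (Ideal.span {x j}) :=
      fun h => hij (D_injective h)
    simp [Finset.mem_singleton, this]
  · exact fun h => absurd (Finset.mem_univ j) h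

/-- a sheaf that is no coordinate hyperplane carries exponent `0`. [folklore] -/
theorem expOf_frame_eq_zero (a : Fin 3 → ℕ) {K : Xs.IdealSheafData} (hK : ∀ j, D j ≠ K) : expOf (frame a) K = 0 := by
  classical
  unfold expOf
  rw [weightOf_ofFn]
  refine Finset.sum_eq_zero fun i _ => ?_
  have : ¬ (affineBlowup.idealSheaf (Ideal.span {x i}) : Xs.IdealSheafData) = K := hK i
  simp [Finset.mem_singleton, this]

/-- `𝓜(frame a) = (∏ x_j ^ a_j)~`. [folklore] -/
theorem monomialIdeal_frame (a : Fin 3 → ℕ) :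
    monomialIdeal (frame a) = affineBlowup.idealSheaf (Ideal.span {∏ j, x j ^ a j}) :=
  (DepthTargets.idealSheaf_span_prod_pow_eq_monomialIdeal 3 x a).symm

/-! ## Stalks -/

/-- the structure-sheaf algebra `S → 𝒪_{Spec S, p}`. -/
noncomputable abbrev stalkAlgebra (p : Xs) : Algebra S (Xs.presheaf.stalk p) :=
  inferInstanceAs (Algebra S ((Spec.structureSheaf S).presheaf.stalk p))

/-- the structure map `φ_p : S →+* 𝒪_p`. -/
noncomputable abbrev φ (p : Xs) : S →+* Xs.presheaf.stalk p :=
  @algebraMap S (Xs.presheaf.stalk p) _ _ (stalkAlgebra p)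

/-- The stalk of `Spec S` at `p` is the localization of `S` at `p` (structure-sheaf algebra). [folklore] -/
theorem isLocalizationAtPrime_stalk (p : Xs) :
    letI := stalkAlgebra p
    IsLocalization.AtPrime (Xs.presheaf.stalk p) p.asIdeal :=
  letI := stalkAlgebra p
  inferInstanceAs (IsLocalization.AtPrime ((Spec.structureSheaf S).presheaf.stalk p) p.asIdeal)

/-- `((s)~)_p = (φ_p s)`. [cite: Hartshorne1977, II Prop. 5.1 (b)] -/
theorem stalkIdeal_span (s : S) (p : Xs) :
    stalkIdeal (affineBlowup.idealSheaf (Ideal.span {s})) p = Ideal.span {φ p s} := by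
  letI := stalkAlgebra p
  rw [DepthTargets.stalkIdeal_idealSheaf_eq, Ideal.map_span, Set.image_singleton]
  rfl

/-- The germ of `s ∈ S` at `p` is a non-unit iff `s ∈ p`. [folklore] -/
theorem mem_maximalIdeal_iff (p : Xs) (s : S) : φ p s ∈ maximalIdeal (Xs.presheaf.stalk p) ↔ s ∈ p.asIdeal := by
  letI := stalkAlgebra p
  haveI := isLocalizationAtPrime_stalk p
  exact IsLocalization.AtPrime.to_map_mem_maximal_iff _ p.asIdeal s

/-- The germ of `s ∈ S` at `p` is a unit iff `s ∉ p`. [folklore] -/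
theorem isUnit_iff (p : Xs) (s : S) : IsUnit (φ p s) ↔ s ∉ p.asIdeal := by
  letI := stalkAlgebra p
  haveI := isLocalizationAtPrime_stalk p
  exact IsLocalization.AtPrime.isUnit_to_map_iff _ p.asIdeal s

/-- The maximal ideal of the stalk at `p` is the extension of `p`. [folklore] -/
theorem maximalIdeal_stalk_eq (p : Xs) : maximalIdeal (Xs.presheaf.stalk p) = p.asIdeal.map (φ p) := by
  letI := stalkAlgebra p
  haveI := isLocalizationAtPrime_stalk p
  exact (IsLocalization.AtPrime.map_eq_maximalIdeal p.asIdeal (Xs.presheaf.stalk p)).symm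

/-! ## The derivation `∂/∂x₁` -/

/-- **`∂/∂x₁` on `S`**: a derivation killing `x₀, x₂`, with `∂ x₁ = 1` and `∂ (x₀² + x₁³x₂ᶜ) = x₁²x₂ᶜ` (`3 = 1`). [folklore] -/
theorem exists_isDeriv_S : ∃ δ : S → S, IsDeriv δ ∧ (∀ j, δ (x j) = if j = 1 then 1 else 0) ∧
    ∀ c : ℕ, δ (x 0 ^ 2 + x 1 ^ 3 * x 2 ^ c) = x 1 ^ 2 * x 2 ^ c := by
  obtain ⟨δ, hδ, he⟩ := (IsDeriv.of_derivation (MvPolynomial.pderiv (R := ZMod 2) (σ := Fin 3) 1)).exists_extend S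
    (originIdeal (ZMod 2) 3).primeCompl
  refine ⟨δ, hδ, fun j => ?_, ?_⟩
  · rw [he, MvPolynomial.pderiv_X]
    by_cases hj : j = 1
    · subst hj; simp
    · rw [Pi.single_eq_of_ne hj, map_zero, if_neg hj]
  · intro c
    have hF : x 0 ^ 2 + x 1 ^ 3 * x 2 ^ c =
        algebraMap P S (MvPolynomial.X 0 ^ 2 + MvPolynomial.X 1 ^ 3 * MvPolynomial.X 2 ^ c) := by
      simp only [map_add, map_mul, map_pow]
    have hd : MvPolynomial.pderiv (1 : Fin 3)
        ((MvPolynomial.X 0 ^ 2 + MvPolynomial.X 1 ^ 3 * MvPolynomial.X 2 ^ c : P)) =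
        3 * (MvPolynomial.X 1 ^ 2 * MvPolynomial.X 2 ^ c) := by
      simp only [map_add, Derivation.leibniz, Derivation.leibniz_pow, MvPolynomial.pderiv_X_self,
        MvPolynomial.pderiv_X_of_ne (show (0 : Fin 3) ≠ 1 by decide),
        MvPolynomial.pderiv_X_of_ne (show (2 : Fin 3) ≠ 1 by decide), smul_zero, smul_eq_mul, nsmul_eq_mul,
        mul_zero, zero_add, mul_one]
      push_cast
      ring
    rw [hF, he, hd, map_mul, map_ofNat, three_eq_one, one_mul, map_mul, map_pow, map_pow]

/-- **`∂/∂x₁` on the stalk `𝒪_p`** (extension through the localisation `S → 𝒪_p`). [folklore] -/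
theorem exists_isDeriv_stalk (p : Xs) : ∃ δ : Xs.presheaf.stalk p → Xs.presheaf.stalk p, IsDeriv δ ∧
    (∀ j, δ (φ p (x j)) = if j = 1 then 1 else 0) ∧
    ∀ c : ℕ, δ (φ p (x 0 ^ 2 + x 1 ^ 3 * x 2 ^ c)) = φ p (x 1 ^ 2 * x 2 ^ c) := by
  letI := stalkAlgebra p
  haveI := isLocalizationAtPrime_stalk p
  obtain ⟨δ, hδ, hx, hf⟩ := exists_isDeriv_S
  obtain ⟨δ', hδ', he⟩ := hδ.exists_extend (Xs.presheaf.stalk p) p.asIdeal.primeCompl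
  refine ⟨δ', hδ', fun j => ?_, fun c => ?_⟩
  · rw [show φ p (x j) = algebraMap S _ (x j) from rfl, he, hx]
    split_ifs <;> simp
  · rw [show φ p (x 0 ^ 2 + x 1 ^ 3 * x 2 ^ c) = algebraMap S _ (x 0 ^ 2 + x 1 ^ 3 * x 2 ^ c) from rfl, he, hf]

/-! ## The residue dichotomy over `𝔽₂` -/

/-- every element of `S = 𝔽₂[X]_{(X)}` is `≡ 0` or `≡ 1 (mod 𝔪)`. [folklore] -/
theorem mem_or_sub_one_mem (a : S) : a ∈ maximalIdeal S ∨ a - 1 ∈ maximalIdeal S := by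
  obtain ⟨⟨q, s⟩, rfl⟩ := IsLocalization.mk'_surjective (originIdeal (ZMod 2) 3).primeCompl a
  have h01 : ∀ c : ZMod 2, c ≠ 0 → c = 1 := by decide
  have hs : MvPolynomial.constantCoeff (s : P) = 1 :=
    h01 _ fun h => s.2 ((mem_originIdeal_iff (F := ZMod 2) (n := 3)).mpr h)
  by_cases hq : MvPolynomial.constantCoeff q = 0
  · exact Or.inl ((IsLocalization.AtPrime.mk'_mem_maximal_iff S (originIdeal (ZMod 2) 3) q s).mpr
      ((mem_originIdeal_iff (F := ZMod 2) (n := 3)).mpr hq))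
  · right
    have hqs : q - s ∈ originIdeal (ZMod 2) 3 :=
      (mem_originIdeal_iff (F := ZMod 2) (n := 3)).mpr (by rw [map_sub, h01 _ hq, hs, sub_self])
    have hmem : (IsLocalization.mk' S q s - 1) * algebraMap P S s ∈ maximalIdeal S := by
      rw [sub_mul, IsLocalization.mk'_spec, one_mul, ← map_sub]
      exact (IsLocalization.AtPrime.to_map_mem_maximal_iff S (originIdeal (ZMod 2) 3) _).mpr hqs
    rcases (maximalIdeal.isMaximal S).isPrime.mem_or_mem hmem with h | h
    · exact h
    · exact absurd ((IsLocalization.AtPrime.to_map_mem_maximal_iff S (originIdeal (ZMod 2) 3) _).mp h) s.2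

/-- the closed point of `Xs`. -/
noncomputable def pt : Xs := (IsLocalRing.closedPoint S : PrimeSpectrum S)

/-- The prime of the closed point is the maximal ideal of `S`. [folklore] -/
theorem pt_asIdeal : pt.asIdeal = maximalIdeal S := rfl

/-- The closed point lies on every coordinate hyperplane. [folklore] -/
theorem pt_mem_support_D (j : Fin 3) : pt ∈ (D j).support := (mem_support_D j pt).mpr (x_mem j)

/-- `φ_pt : S → 𝒪_pt` is onto (localising a local ring at its maximal ideal). [folklore] -/
theorem φ_pt_surjective : Function.Surjective (φ pt) := by
  letI := stalkAlgebra pt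
  haveI := isLocalizationAtPrime_stalk pt
  intro g
  obtain ⟨⟨a, s⟩, rfl⟩ := IsLocalization.mk'_surjective pt.asIdeal.primeCompl g
  have hs : IsUnit (s : S) := by
    by_contra h
    exact s.2 ((IsLocalRing.mem_maximalIdeal _).mpr h)
  obtain ⟨u, hu⟩ := hs
  refine ⟨a * ↑u⁻¹, ?_⟩
  rw [show φ pt (a * ↑u⁻¹) = algebraMap S _ (a * ↑u⁻¹) from rfl, IsLocalization.eq_mk'_iff_mul_eq]
  show algebraMap S _ (a * ↑u⁻¹) * algebraMap S _ (s : S) = algebraMap S _ a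
  rw [← map_mul, mul_assoc, ← hu, Units.inv_mul, mul_one]

/-- **residue dichotomy at the closed point**: every germ is `≡ 0` or `≡ 1 (mod 𝔪_pt)`. [folklore] -/
theorem stalk_mem_or_sub_one_mem (g : Xs.presheaf.stalk pt) :
    g ∈ maximalIdeal (Xs.presheaf.stalk pt) ∨ g - 1 ∈ maximalIdeal (Xs.presheaf.stalk pt) := by
  obtain ⟨a, rfl⟩ := φ_pt_surjective g
  rcases mem_or_sub_one_mem a with h | h
  · exact Or.inl ((mem_maximalIdeal_iff pt a).mpr h)
  · refine Or.inr ?_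
    rw [← map_one (φ pt), ← map_sub]
    exact (mem_maximalIdeal_iff pt _).mpr h

/-- `𝔪_pt = (φ x₀, φ x₁, φ x₂)`. [folklore] -/
theorem maximalIdeal_pt_eq : maximalIdeal (Xs.presheaf.stalk pt) = Ideal.span (Set.range fun j => φ pt (x j)) := by
  rw [maximalIdeal_stalk_eq, pt_asIdeal, ← span_range_x, Ideal.map_span, ← Set.range_comp]
  rfl

end JetModel

end Summit.ResolutionOfSingularities.ResolutionOfSingularities.Theorems.DeltaCutClasses
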